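import Mathlib
import Summits.RiemannHypothesis.RiemannHypothesis.Theorems.WeilParityOffLineParityDetectionTorusHalfLine
import Summits.RiemannHypothesis.RiemannHypothesis.Theorems.WeilParityOffLineParityDetectionLocLaplace
import Summits.RiemannHypothesis.RiemannHypothesis.Theorems.WeilParityOffLineParityDetectionLocLayerBounds
import Summits.RiemannHypothesis.RiemannHypothesis.Theorems.WeilParityOffLineParityDetectionLocProfile
import HarnessLib

/-!
# Crux `OffLineParityDetection`, line `registered`: stub TORUS-LOW (top-heaviness for low ordinates)

Route `WeilParity`, crux
`Summit.RiemannHypothesis.RiemannHypothesis.Theses.WeilParity.OffLineParityDetection`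
(item stmt-RiemannHypothesis-15431), line `registered`.  This file proves the registered stub
`stub_torusTopHeavyLowOrdinates` BY NAME, with the registered signature (`ζ`-free, RH-free real
analysis; TORUS-analysis §5.3, Theorem LOW, with test vector `e^{-2η₀u}` in place of `e^{-η₀u}`).

Setting: a finite nonempty top layer `T ⊂ {Re ρ = 1/2 + η₀}` (`η₀ > 0`) with positive weights `w`
and LOW ordinates `|Im ρ| ≤ η₀`; `F_f(ρ) = ∫_{u>0} f(u) e^{-(ρ-1/2)u} du`, `‖f‖² = ∫_{u>0} f²`,
`gain(a, f) = Σ_{ρ∈T} w(ρ) Re(e^{2i(Im ρ)a} F_f(ρ)²)`.  Claim: for some `δ > 0`, `a`, `D ≥ 0`, every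
smooth compactly supported real profile on `[0, ∞)` has `-gain(a, f) ≤ D‖f‖²`, and some such
profile with `‖f‖² > 0` has `gain(a, f) ≥ (D + δ)‖f‖²`.

## Proof (phase point `a = 0`, all constants explicit; `W = Σ_T w > 0`)

* DANGER (`torusLow_danger` of the helper file, summed with the weights): at `a = 0`,
  `-Re F_f(ρ)² ≤ (Im F_f(ρ))² ≤ ‖f‖²/(4η₀)` for `|Im ρ| ≤ η₀`, so `D = W/(4η₀)` works.
* GAIN: `δ = W/(100η₀)`; profile `f = φ · e^{-2η₀u}` with `φ` a `ContDiffBump` centred at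
  `(ε + U)/2`, radii `(U ∓ ε)/2`, `ε = 1/(1000η₀)`, `U = 100/η₀` (smooth, `tsupport ⊆ [0, U + ε]`,
  `φ = 1` on `[ε, U]`, `0 ≤ φ ≤ 1`).  Then `‖f‖² ≤ ∫₀^∞ e^{-4η₀u} = 1/(4η₀)`, `‖f‖² > 0`, and for
  `ρ ∈ T`: `F_f(ρ) = 1/c - E`, `c = 3η₀ + i Im ρ` (`torusLow_lap_exp`), `η₀‖E‖ ≤ e ε η₀ + e^{-200}
  ≤ 1/100` (`torusLow_trunc_error`), `η₀² Re(1/c)² ≥ 2/25`, `η₀‖1/c‖ ≤ 1/3`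
  (`torusLow_ideal_bounds`), whence `η₀² Re F_f(ρ)² ≥ 2/25 - 2/300 - 10⁻⁴ ≥ 13/200`
  (`loc_re_sub_sq_ge`) and `gain(0, f) ≥ (13/200) W/η₀² = (D + δ)/(4η₀) ≥ (D + δ)‖f‖²`.

Nothing about `ζ`, Weil tests or the explicit formula is used or stated here.
-/

set_option linter.dupNamespace false

noncomputable section

namespace Summit.RiemannHypothesis.RiemannHypothesis.Theorems.WeilParityOffLineParityDetection

open MeasureTheory Set Filter
open scoped ComplexConjugate
open Literature.NumberTheory.LFunctions

/-- Stub **TORUS-LOW** of crux `OffLineParityDetection` (line `registered`), registered signature: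
if every ordinate of the top layer is at most the offset, `|Im ρ| ≤ η₀`, the mirror-pairing form
`gain(a, f) = Σ_T w Re(e^{2i(Im ρ)a} F_f(ρ)²)`, `F_f(ρ) = ∫₀^∞ f e^{-(ρ-1/2)u} du`, is top-heavy at
the phase point `a = 0`: with `D = (Σ_T w)/(4η₀)` and `δ = (Σ_T w)/(100η₀)`, every smooth compactly
supported profile on `[0, ∞)` has danger `-gain(0, f) ≤ D‖f‖²` (`torusLow_danger`, summed), and the
profile `f(u) = φ(u) e^{-2η₀u}` — `φ` a smooth plateau bump, `= 1` on `[1/(1000η₀), 100/η₀]`,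
supported in `[0, 100/η₀ + 1/(1000η₀)]` — gains `≥ (D + δ)‖f‖²`: `F_f(ρ) = 1/(3η₀ + iγ) - E` with
`η₀‖E‖ ≤ e/1000 + 1/201 ≤ 1/100` (`torusLow_lap_exp`, `torusLow_trunc_error`), so
`η₀² Re F_f(ρ)² ≥ 2/25 - 1/150 - 10⁻⁴ ≥ 13/200` (`torusLow_ideal_bounds`, `loc_re_sub_sq_ge`),
while `‖f‖² ≤ ∫₀^∞ e^{-4η₀u} = 1/(4η₀)` and `(D + δ)/(4η₀) = (13/200)(Σ w)/η₀²`. [folklore] -/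
theorem stub_torusTopHeavyLowOrdinates :
    ∀ η₀ : ℝ, 0 < η₀ → ∀ T : Finset ℂ, T.Nonempty → (∀ ρ ∈ T, ρ.re = 1 / 2 + η₀) →
      ∀ w : ℂ → ℝ, (∀ ρ ∈ T, 0 < w ρ) →
      (∀ ρ ∈ T, |ρ.im| ≤ η₀) →
      ∃ δ : ℝ, 0 < δ ∧ ∃ a : ℝ, ∃ D : ℝ, 0 ≤ D ∧
        (∀ f : ℝ → ℝ, ContDiff ℝ (⊤ : ℕ∞) f → HasCompactSupport f → tsupport f ⊆ Set.Ici 0 →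
          -(∑ ρ ∈ T, w ρ * (Complex.exp (2 * (ρ.im : ℂ) * (a : ℂ) * Complex.I) *
              (∫ u in Set.Ioi (0 : ℝ), (f u : ℂ) * Complex.exp (-((ρ - 1 / 2) * (u : ℂ)))) ^ 2).re)
            ≤ D * ∫ u in Set.Ioi (0 : ℝ), f u ^ 2) ∧
        (∃ f : ℝ → ℝ, ContDiff ℝ (⊤ : ℕ∞) f ∧ HasCompactSupport f ∧ tsupport f ⊆ Set.Ici 0 ∧
          0 < ∫ u in Set.Ioi (0 : ℝ), f u ^ 2 ∧
          (D + δ) * ∫ u in Set.Ioi (0 : ℝ), f u ^ 2 ≤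
            ∑ ρ ∈ T, w ρ * (Complex.exp (2 * (ρ.im : ℂ) * (a : ℂ) * Complex.I) *
              (∫ u in Set.Ioi (0 : ℝ), (f u : ℂ) * Complex.exp (-((ρ - 1 / 2) * (u : ℂ)))) ^ 2).re) := by
  intro η hη T hT hTre w hw hlow
  obtain ⟨W, hW⟩ : ∃ W : ℝ, W = ∑ ρ ∈ T, w ρ := ⟨_, rfl⟩
  have hWpos : 0 < W := by
    rw [hW]
    exact Finset.sum_pos hw hT
  have hphase : ∀ ρ : ℂ, Complex.exp (2 * (ρ.im : ℂ) * ((0 : ℝ) : ℂ) * Complex.I) = 1 := fun ρ ↦ by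
    simp
  refine ⟨W / (100 * η), div_pos hWpos (by positivity), 0, W / (4 * η),
    (div_pos hWpos (by positivity)).le, ?_, ?_⟩
  · -- the danger bound, summed over the layer
    intro f hf hfc _
    simp only [hphase, one_mul]
    rw [← Finset.sum_neg_distrib]
    calc ∑ ρ ∈ T, -(w ρ * ((∫ u in Set.Ioi (0 : ℝ),
            (f u : ℂ) * Complex.exp (-((ρ - 1 / 2) * (u : ℂ)))) ^ 2).re)
        ≤ ∑ ρ ∈ T, w ρ * (1 / (4 * η) * ∫ u in Set.Ioi (0 : ℝ), f u ^ 2) := by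
          refine Finset.sum_le_sum fun ρ hρ ↦ ?_
          have h := torusLow_danger f hf.continuous hfc η hη ρ (hTre ρ hρ) (hlow ρ hρ)
          nlinarith [h, hw ρ hρ]
      _ = W / (4 * η) * ∫ u in Set.Ioi (0 : ℝ), f u ^ 2 := by
          rw [← Finset.sum_mul, ← hW]
          ring
  · -- the gaining profile `f = φ · e^{-2ηu}`
    simp only [hphase, one_mul]
    obtain ⟨ε, hε⟩ : ∃ ε : ℝ, ε = 1 / (1000 * η) := ⟨_, rfl⟩
    obtain ⟨U, hU⟩ : ∃ U : ℝ, U = 100 / η := ⟨_, rfl⟩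
    have hεpos : 0 < ε := by
      rw [hε]
      positivity
    have hεU : ε < U := by
      rw [hε, hU, div_lt_div_iff₀ (by positivity) hη]
      nlinarith
    obtain ⟨φ, hrIn, hrOut⟩ : ∃ φ : ContDiffBump ((ε + U) / 2),
        φ.rIn = (U - ε) / 2 ∧ φ.rOut = (U + ε) / 2 :=
      ⟨⟨(U - ε) / 2, (U + ε) / 2, by linarith, by linarith⟩, rfl, rfl⟩
    have hφ0 : ∀ u, 0 ≤ φ u := fun u ↦ φ.nonneg
    have hφ1 : ∀ u, φ u ≤ 1 := fun u ↦ φ.le_one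
    have hφone : ∀ u ∈ Icc ε U, φ u = 1 := fun u hu ↦ φ.one_of_mem_closedBall (by
      rw [Metric.mem_closedBall, hrIn, Real.dist_eq, abs_le]
      constructor <;> linarith [hu.1, hu.2])
    have hφzero : ∀ u ≤ 0, φ u = 0 := fun u hu ↦ φ.zero_of_le_dist (by
      rw [hrOut, Real.dist_eq, abs_of_nonpos (by linarith)]
      linarith)
    obtain ⟨f, hfdef⟩ : ∃ f : ℝ → ℝ, ∀ u, f u = φ u * Real.exp (-(2 * η * u)) := ⟨_, fun u ↦ rfl⟩
    have hfeq : f = fun u ↦ φ u * Real.exp (-(2 * η * u)) := funext hfdef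
    have hfs : ContDiff ℝ (⊤ : ℕ∞) f := by
      rw [hfeq]
      exact φ.contDiff.mul (by fun_prop)
    have hfc : HasCompactSupport f := by
      rw [hfeq]
      exact φ.hasCompactSupport.mul_right
    have hft : tsupport f ⊆ Ici 0 := by
      rw [hfeq]
      refine (tsupport_mul_subset_left (f := fun u ↦ φ u)
        (g := fun u ↦ Real.exp (-(2 * η * u)))).trans ?_
      rw [φ.tsupport_eq, hrOut]
      intro x hx
      rw [Metric.mem_closedBall, Real.dist_eq, abs_le] at hx
      simp only [mem_Ici]
      linarith [hx.1]
    have hfcont : Continuous f := hfs.continuous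
    have hf2i : Integrable (fun u ↦ f u ^ 2) := loc_integrable_sq hfcont hfc
    -- energy from above: `‖f‖² ≤ ∫₀^∞ e^{-4ηu} = 1/(4η)`
    have hE_le : ∫ u in Ioi (0 : ℝ), f u ^ 2 ≤ 1 / (4 * η) := by
      have hexp : IntegrableOn (fun u : ℝ ↦ Real.exp (-(4 * η) * u)) (Ioi 0) :=
        exp_neg_integrableOn_Ioi 0 (by positivity)
      have hv : ∫ u in Ioi (0 : ℝ), Real.exp (-(4 * η) * u) = 1 / (4 * η) := by
        rw [integral_exp_mul_Ioi (by linarith) 0, mul_zero, Real.exp_zero, neg_div_neg_eq]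
      rw [← hv]
      refine setIntegral_mono_on hf2i.integrableOn hexp measurableSet_Ioi fun u _ ↦ ?_
      have h2 : Real.exp (-(2 * η * u)) ^ 2 = Real.exp (-(4 * η) * u) := by
        rw [sq, ← Real.exp_add]
        congr 1
        ring
      rw [hfdef, mul_pow, h2]
      exact mul_le_of_le_one_left (Real.exp_pos _).le (pow_le_one₀ (hφ0 u) (hφ1 u))
    -- energy from below: `f` is continuous, nonnegative, `f((ε+U)/2) ≠ 0`
    have hE_pos : 0 < ∫ u in Ioi (0 : ℝ), f u ^ 2 := by
      rw [setIntegral_eq_integral_of_forall_compl_eq_zero (fun u hu ↦ by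
        rw [hfdef, hφzero u (not_lt.1 fun h ↦ hu h), zero_mul, zero_pow two_ne_zero])]
      refine (hfcont.pow 2).integral_pos_of_hasCompactSupport_nonneg_nonzero (x := (ε + U) / 2)
        (hfc.comp_left (g := fun x : ℝ ↦ x ^ 2) (zero_pow two_ne_zero)) (fun u ↦ sq_nonneg (f u)) ?_
      have h1 : φ ((ε + U) / 2) = 1 := hφone _ ⟨by linarith, by linarith⟩
      rw [hfdef, h1, one_mul]
      exact pow_ne_zero _ (Real.exp_pos _).ne'
    -- the gain of `f` at each point of the layer: `η² Re F_f(ρ)² ≥ 13/200`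
    have hgain : ∀ ρ ∈ T, 13 / 200 ≤ η ^ 2 *
        ((∫ u in Ioi (0 : ℝ), (f u : ℂ) * Complex.exp (-((ρ - 1 / 2) * (u : ℂ)))) ^ 2).re := by
      intro ρ hρ
      set z : ℂ := ρ - 1 / 2 with hz
      have hzre : z.re = η := by
        simp [hz, hTre ρ hρ]
      have hzim : z.im = ρ.im := by
        simp [hz]
      obtain ⟨c, hc⟩ : ∃ c : ℂ, c = ((2 * η : ℝ) : ℂ) + z := ⟨_, rfl⟩
      have hcre : c.re = 3 * η := by
        rw [hc, Complex.add_re, Complex.ofReal_re, hzre]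
        ring
      have hcim : |c.im| ≤ η := by
        rw [hc, Complex.add_im, Complex.ofReal_im, zero_add, hzim]
        exact hlow ρ hρ
      have hc0 : c ≠ 0 := by
        intro h0
        rw [h0] at hcre
        simp at hcre
        linarith
      -- the ideal value `∫₀^∞ e^{-2ηu} e^{-zu} du = 1/c`
      have hA : ∫ u in Ioi (0 : ℝ), ((Real.exp (-(2 * η * u)) : ℝ) : ℂ) *
          Complex.exp (-(z * (u : ℂ))) = 1 / c := by
        rw [hc]
        exact torusLow_lap_exp (by rw [hzre]; positivity)
      have hIf : IntegrableOn (fun u : ℝ ↦ (f u : ℂ) * Complex.exp (-(z * (u : ℂ)))) (Ioi 0) :=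
        (loc_integrable_lapIntegrand hfcont hfc z).integrableOn
      have hIA : IntegrableOn (fun u : ℝ ↦ ((Real.exp (-(2 * η * u)) : ℝ) : ℂ) *
          Complex.exp (-(z * (u : ℂ)))) (Ioi 0) :=
        Integrable.of_integral_ne_zero (by rw [hA]; exact one_div_ne_zero hc0)
      -- the truncation error `E = ∫₀^∞ (1 - φ) e^{-2ηu} e^{-zu} du`
      obtain ⟨E, hEdef⟩ : ∃ E : ℂ, E = ∫ u in Ioi (0 : ℝ),
          (((1 - φ u) * Real.exp (-(2 * η * u)) : ℝ) : ℂ) * Complex.exp (-(z * (u : ℂ))) := ⟨_, rfl⟩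
      have hIE : IntegrableOn (fun u : ℝ ↦ (((1 - φ u) * Real.exp (-(2 * η * u)) : ℝ) : ℂ) *
          Complex.exp (-(z * (u : ℂ)))) (Ioi 0) := by
        have e : (fun u : ℝ ↦ (((1 - φ u) * Real.exp (-(2 * η * u)) : ℝ) : ℂ) *
            Complex.exp (-(z * (u : ℂ)))) = fun u ↦ ((Real.exp (-(2 * η * u)) : ℝ) : ℂ) *
              Complex.exp (-(z * (u : ℂ))) - (f u : ℂ) * Complex.exp (-(z * (u : ℂ))) := by
          funext u
          rw [hfdef]
          push_cast
          ring
        rw [e]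
        exact hIA.sub hIf
      have hsplit : (∫ u in Ioi (0 : ℝ), (f u : ℂ) * Complex.exp (-(z * (u : ℂ)))) = 1 / c - E := by
        rw [← hA, hEdef, ← integral_sub hIA hIE]
        refine setIntegral_congr_fun measurableSet_Ioi fun u _ ↦ ?_
        rw [hfdef]
        push_cast
        ring
      have hEn : η * ‖E‖ ≤ 1 / 100 := by
        have h1 : ‖E‖ ≤ Real.exp 1 * ε + Real.exp (-(2 * η * U)) / η := by
          rw [hEdef]
          exact torusLow_trunc_error hφ0 hφ1 hεpos hφone hη hzre
        have h2 : Real.exp 1 * ε ≤ 3 / (1000 * η) := by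
          have h3 : Real.exp 1 ≤ 3 := by linarith [Real.exp_one_lt_d9]
          rw [hε]
          calc Real.exp 1 * (1 / (1000 * η)) ≤ 3 * (1 / (1000 * η)) := by gcongr
            _ = 3 / (1000 * η) := by ring
        have h3 : Real.exp (-(2 * η * U)) ≤ 1 / 201 := by
          have hU' : 2 * η * U = 200 := by
            rw [hU]
            field_simp
            ring
          rw [hU', Real.exp_neg, one_div]
          exact inv_anti₀ (by norm_num) (by linarith [Real.add_one_le_exp (200 : ℝ)])
        have h4 : ‖E‖ ≤ 3 / (1000 * η) + (1 / 201) / η :=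
          h1.trans (add_le_add h2 (div_le_div_of_nonneg_right h3 hη.le))
        calc η * ‖E‖ ≤ η * (3 / (1000 * η) + (1 / 201) / η) := mul_le_mul_of_nonneg_left h4 hη.le
          _ = 3 / 1000 + 1 / 201 := by
              field_simp
          _ ≤ 1 / 100 := by norm_num
      obtain ⟨hA1, hA2⟩ := torusLow_ideal_bounds hη hcre hcim
      have hRS := mul_le_mul_of_nonneg_left (loc_re_sub_sq_ge (1 / c) E) (sq_nonneg η)
      have hX : η * ‖1 / c‖ * (η * ‖E‖) ≤ 1 / 3 * (1 / 100) :=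
        mul_le_mul hA2 hEn (by positivity) (by norm_num)
      have hY : (η * ‖E‖) ^ 2 ≤ (1 / 100) ^ 2 := pow_le_pow_left₀ (by positivity) hEn 2
      rw [hsplit]
      nlinarith [hRS, hA1, hX, hY]
    -- assembly
    refine ⟨f, hfs, hfc, hft, hE_pos, ?_⟩
    have hDδ : 0 ≤ W / (4 * η) + W / (100 * η) := by positivity
    calc (W / (4 * η) + W / (100 * η)) * ∫ u in Ioi (0 : ℝ), f u ^ 2
        ≤ (W / (4 * η) + W / (100 * η)) * (1 / (4 * η)) := mul_le_mul_of_nonneg_left hE_le hDδ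
      _ = ∑ ρ ∈ T, w ρ * (13 / 200 / η ^ 2) := by
          rw [← Finset.sum_mul, ← hW]
          field_simp
          ring
      _ ≤ ∑ ρ ∈ T, w ρ * ((∫ u in Set.Ioi (0 : ℝ),
            (f u : ℂ) * Complex.exp (-((ρ - 1 / 2) * (u : ℂ)))) ^ 2).re := by
          refine Finset.sum_le_sum fun ρ hρ ↦ mul_le_mul_of_nonneg_left ?_ (hw ρ hρ).le
          rw [div_le_iff₀ (by positivity)]
          have := hgain ρ hρ
          linarith

end Summit.RiemannHypothesis.RiemannHypothesis.Theorems.WeilParityOffLineParityDetection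

end
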